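import Literature.AlgebraicGeometry.HodgeTheory.SubvariationIrreducibleOfFlatSpan
import Literature.AlgebraicGeometry.HodgeTheory.FlatEndomorphismEigenspaceSubvariation
import Literature.AlgebraicGeometry.HodgeTheory.FibrewiseDeckRelations
import Literature.AlgebraicGeometry.HodgeTheory.DirectImageEndomorphism
import Literature.AlgebraicGeometry.HodgeTheory.BettiUniverseAxioms
import Literature.AlgebraicGeometry.HodgeTheory.BettiUniverseEigenspacePieces
import Literature.AlgebraicGeometry.HodgeTheory.BettiUniverseKunnethHodgePowersNormalForm
import Literature.AlgebraicGeometry.HodgeTheory.DiagonalSymmetryStability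
import Literature.AlgebraicGeometry.HodgeTheory.ComplexConjugationHolds
import Mathlib.LinearAlgebra.Eigenspace.Semisimple
import Mathlib.FieldTheory.Separable
import HarnessLib

/-!
# The eigen-Hodge numbers of a fibrewise automorphism of finite order are constant over the base

Family `hodge`, layer `Literature/AlgebraicGeometry/HodgeTheory`; THEOREMS ONLY (no definition, no
named fact). Requested 2026-08-29 by the planner of route `HodgeConjecture/Q8SymplecticPowers` (crux
K1Q, stub S4 `stub_transcendentalQuaternionicPartQ`, clauses (o) `p_g^{τ²=+1}(X_s) = 0` and (o′)
`p_g^{τ²=−1}(X_s) > 0`): the numbers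
`dim_ℂ (ker((τ_s^*)² ⊗ ℂ − c) ∩ H^{2,0}(X_s))` must be the SAME at every member `s` of the family, so
that they can be certified at one member and transported to all.

Setting (the tree's Betti universe, `BettiUniverseAxioms`): `π : 𝒳 → S` a smooth projective family of
relative dimension `n` (`IsSmoothProjectiveFamily`), `𝒳`, `S` quasi-projective, `S` smooth of
dimension `d` and IRREDUCIBLE, `Rᵏ π_* ℂ` locally trivial (`hU`), `g : 𝒳 → 𝒳` an endomorphism over
`S` (`g ≫ π = π`) whose fibre maps `g_t = fiberOverEnd π g _ t` act on `Hᵏ(X_t(ℂ); ℚ)`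
(`A_t := pull g_t k`) with `A_t ^ m = 1` for all `t`, `m ≥ 1`; the Hodge structure of `X_t` is
`hodge hHD (hπ.isSmoothProjective t) k` (`hHD : exists_isReal_hodgeModel`, in the cell's statements the
proved `exists_isReal_hodgeModel_holds`).

* §1 Eigenspaces of an operator of finite order (pure linear algebra over `ℂ`, private helpers): `B ^ m = 1` ⇒
  `ker(B − c) = 0` unless `c ^ m = 1` (`eigenspace_eq_bot_of_pow_eq_one_of_pow_ne_one`); the
  eigenspaces for the `m`-th roots of unity form a splitting — independent
  (`iSupIndep_eigenspace_nthRoots`) with supremum `⊤` (`iSup_eigenspace_nthRoots_eq_top`, via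
  Mathlib's `Module.End.isSemisimple_of_squarefree_aeval_eq_zero` for `X ^ m − 1`).
* §2 The family: `β ∘ (A_t ⊗ ℂ) = (g_t)^*_ℂ ∘ β` (`ofRatClassBaseChange_baseChange_pull_eq`); rational
  transports intertwine the `A_t` (`ratTransport_pull_fiberOverEnd`, from the tree's
  `transportFun_map_fiberHom`); hence `T_ℂ⁻¹ ker(A_t ⊗ ℂ − c) = ker(A_s ⊗ ℂ − c)`
  (`comap_baseChange_eigenspace_eq_of_semiconj`).
* §3 **`finrank_eigenspace_pull_fiberOverEnd_inf_hodge_F_eq`** — for every `c : ℂ`, `p : ℤ` and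
  `s, t ∈ S(ℂ)`: `dim(ker(A_t ⊗ ℂ − c) ∩ F^p Hᵏ(X_t)) = dim(ker(A_s ⊗ ℂ − c) ∩ F^p Hᵏ(X_s))`. PROOF:
  the eigenspaces of `A_s ⊗ ℂ` for the `m`-th roots of unity are a flat splitting by complex
  SUB-VARIATIONS (the tree's `isSubvariation_eigenspace` for the flat, type-preserving field
  `t ↦ (g_t)^*_ℂ`), so at every admissible state the additivity `hadd` holds
  (`HodgeStructure.sum_finrank_inf_F_eq_of_splitting` over the bridge
  `comap_eq_iSup_inf_piece_comapEquiv_of_isHodgeSubspace_map`), and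
  `flatSplitting_finrank_inf_F_eq_forall_of_irreducibleSpace` (`SubvariationHodgeNumbersConstant` §4,
  Voisin I Prop. 9.20 over Griffiths' holomorphy; admissible states exist everywhere on an
  irreducible base) gives constancy; reading the transported state back at `t` uses §2.
  Variants: `…_sq_…` for the SQUARE `A_t²` (the route's `τ²`: `g := τ ≫ τ`,
  `pull (τ ≫ τ)_t = A_t ^ 2`), and `…_piece_…` with the top piece `H^{k,0} = F^k`
  (`hodge_F_self_eq_piece_self_zero`), in particular
  `finrank_eigenspace_sq_inf_hodge_piece_two_zero_eq` = the (o)(o′) numbers of K1Q verbatim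
  (`k = 2`, `piece 2 0`); `eigenspace_sq_inf_piece_two_zero_clauses_forall` packages it as
  «(o) ∧ (o′) at one `s₀` ⇒ (o) ∧ (o′) at every `s`» under `(τ_t^*)⁴ = 1`.

Honest scope: constancy only — the VALUES `0` (o) and `> 0` (o′) at one member are the cell's
Esnault–Viehweg residue computation, not touched here; nothing in this file bears on the Hodge
conjecture itself.

## References
* [VoisinHodgeI2002] C. Voisin, Hodge Theory and Complex Algebraic Geometry I, CUP 2002: §9.3.1
  Prop. 9.20 (Hodge numbers constant in families), §10.2.1 Thm. 10.3, §7.1.1.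
* [Deligne1987] P. Deligne, Un théorème de finitude pour la monodromie, Progr. Math. 67 (1987),
  §1.11–1.13 (sub-variations; eigenspaces of flat endomorphisms).
* [VoisinHodgeII2003] C. Voisin, Hodge Theory and Complex Algebraic Geometry II, CUP 2003, §3.1.2
  (the rational local system and its transports).
* [HatcherAT2002] A. Hatcher, Algebraic Topology, CUP 2002, §3.1 p. 198 (naturality of coefficients).
-/

noncomputable section

open CategoryTheory AlgebraicGeometry
open _root_.Topology _root_.Filter Set Module Submodule
open scoped TensorProduct
open Literature.AlgebraicTopology.SingularHomology
open Literature.AlgebraicGeometry.Motives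
open Literature.AlgebraicGeometry.HodgeTheory.BettiUniverse

namespace Literature.AlgebraicGeometry.HodgeTheory

section HodgeTheory

/-! ### §1 Eigenspaces of an operator of finite order -/

section FiniteOrder

variable {E : Type*} [AddCommGroup E] [Module ℂ E]

/-- An eigenvalue `c` of an operator with `B ^ m = 1` satisfies `c ^ m = 1`; equivalently
`ker(B − c) = 0` if `c ^ m ≠ 1`. [folklore] -/
private theorem eigenspace_eq_bot_of_pow_eq_one_of_pow_ne_one {B : Module.End ℂ E} {m : ℕ} (hB : B ^ m = 1)
    {c : ℂ} (hc : c ^ m ≠ 1) : B.eigenspace c = ⊥ := by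
  rw [Submodule.eq_bot_iff]
  intro x hx
  have hx' : B x = c • x := Module.End.mem_eigenspace_iff.1 hx
  have hpow : ∀ j : ℕ, (B ^ j) x = c ^ j • x := by
    intro j
    induction j with
    | zero => rw [pow_zero, pow_zero, one_smul, Module.End.one_apply]
    | succ j ih => rw [pow_succ, Module.End.mul_apply, hx', map_smul, ih, smul_smul, pow_succ']
  have h := hpow m
  rw [hB, Module.End.one_apply] at h
  have h' : (c ^ m - 1) • x = 0 := by rw [sub_smul, one_smul, ← h]; exact sub_self _
  rcases smul_eq_zero.1 h' with h1 | h1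
  · exact absurd (sub_eq_zero.1 h1) hc
  · exact h1

/-- The eigenspaces of an operator, indexed by the `m`-th roots of unity, are independent.
[folklore] -/
private theorem iSupIndep_eigenspace_nthRoots (B : Module.End ℂ E) (m : ℕ) :
    iSupIndep fun μ : ↥(Polynomial.nthRootsFinset m (1 : ℂ)) ↦ B.eigenspace (μ : ℂ) :=
  B.eigenspaces_iSupIndep.comp Subtype.val_injective

/-- **An operator of finite order is diagonalisable**: if `B ^ m = 1` (`m ≥ 1`) on a finite-dimensional
`ℂ`-space, the eigenspaces for the `m`-th roots of unity span everything (`X ^ m − 1` is separable,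
so `B` is semisimple: Mathlib's `isSemisimple_of_squarefree_aeval_eq_zero` and
`IsSemisimple.iSup_eigenspace_eq_top`). [folklore] -/
private theorem iSup_eigenspace_nthRoots_eq_top [FiniteDimensional ℂ E] {B : Module.End ℂ E} {m : ℕ}
    (hm : 0 < m) (hB : B ^ m = 1) :
    ⨆ μ : ↥(Polynomial.nthRootsFinset m (1 : ℂ)), B.eigenspace (μ : ℂ) = ⊤ := by
  have hsep : (Polynomial.X ^ m - Polynomial.C (1 : ℂ)).Separable :=
    Polynomial.separable_X_pow_sub_C 1 (by exact_mod_cast hm.ne') one_ne_zero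
  have h0 : Polynomial.aeval B (Polynomial.X ^ m - Polynomial.C (1 : ℂ)) = 0 := by
    rw [map_sub, map_pow, Polynomial.aeval_X, Polynomial.aeval_C, hB, map_one, sub_self]
  have hss := Module.End.isSemisimple_of_squarefree_aeval_eq_zero hsep.squarefree h0
  refine top_le_iff.1 ?_
  rw [← hss.iSup_eigenspace_eq_top]
  refine iSup_le fun c ↦ ?_
  by_cases hc : c ^ m = 1
  · exact le_iSup (fun μ : ↥(Polynomial.nthRootsFinset m (1 : ℂ)) ↦ B.eigenspace (μ : ℂ))
      ⟨c, (Polynomial.mem_nthRootsFinset hm 1).2 hc⟩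
  · rw [eigenspace_eq_bot_of_pow_eq_one_of_pow_ne_one hB hc]
    exact bot_le

/-- For `ℚ`-spaces `V`, `W`, operators `A`, `A'` intertwined by a linear equivalence `T`
(`T ∘ A = A' ∘ T`), the complexified eigenspaces correspond: `T_ℂ⁻¹ ker(A' ⊗ ℂ − c) = ker(A ⊗ ℂ − c)`.
[folklore] -/
private theorem comap_baseChange_eigenspace_eq_of_semiconj {V W : Type*} [AddCommGroup V] [Module ℚ V]
    [AddCommGroup W] [Module ℚ W] (T : V ≃ₗ[ℚ] W) (A : Module.End ℚ V) (A' : Module.End ℚ W)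
    (h : ∀ v, T (A v) = A' (T v)) (c : ℂ) :
    (Module.End.eigenspace (A'.baseChange ℂ) c).comap ((T : V →ₗ[ℚ] W).baseChange ℂ) =
      Module.End.eigenspace (A.baseChange ℂ) c := by
  have hcomp : (T : V →ₗ[ℚ] W) ∘ₗ A = A' ∘ₗ (T : V →ₗ[ℚ] W) := LinearMap.ext fun v ↦ h v
  have hcommC : ∀ x, ((T : V →ₗ[ℚ] W).baseChange ℂ) (A.baseChange ℂ x) =
      A'.baseChange ℂ (((T : V →ₗ[ℚ] W).baseChange ℂ) x) := fun x ↦ by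
    have := congrArg (fun f : V →ₗ[ℚ] W ↦ f.baseChange ℂ x) hcomp
    simpa only [LinearMap.baseChange_comp, LinearMap.comp_apply] using this
  have hinj : Function.Injective ((T : V →ₗ[ℚ] W).baseChange ℂ) :=
    (T.baseChange ℚ ℂ V W).injective
  ext x
  rw [Submodule.mem_comap, Module.End.mem_eigenspace_iff, Module.End.mem_eigenspace_iff, ← hcommC,
    ← map_smul, hinj.eq_iff]

end FiniteOrder

/-! ### §2 The family: complexification, flatness of the fibre maps, the top Hodge piece -/

section Family

variable {𝒳 S : SchemeOver ℂ}

/-- `β ∘ (φ^* ⊗ ℂ) = φ^*_ℂ ∘ β`: the complexified rational pull-back read on `Hᵏ(·(ℂ); ℂ)`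
(the same statement is proved as `ofRatClassBaseChange_baseChange_pull` in the summit-side file
`Summits/HodgeConjecture/HodgeConjecture/Theorems/Q8SymplecticPowersTranscendentalIrreducibleOfFlatSpan`,
which Literature cannot import; restated here so Literature users have it).
[cite: HatcherAT2002, §3.1 p. 198] [cite: VoisinHodgeI2002, §7.1.1] -/
theorem ofRatClassBaseChange_baseChange_pull_eq {X Y : SchemeOver ℂ} (φ : Y ⟶ X) (k : ℕ)
    (x : ℂ ⊗[ℚ] bettiCohomology X k) :
    ofRatClassBaseChange (ComplexPoints Y) k ((pull φ k).baseChange ℂ x) =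
      complexBetti.map φ k (ofRatClassBaseChange (ComplexPoints X) k x) := by
  induction x using TensorProduct.induction_on with
  | zero =>
    rw [map_zero, map_zero]
    exact (map_zero _).symm
  | tmul c v =>
    rw [LinearMap.baseChange_tmul, ofRatClassBaseChange_tmul, ofRatClassBaseChange_tmul, ofRatClass_pull]
    exact (map_smul _ c _).symm
  | add x y hx hy =>
    rw [map_add, map_add, hx, hy, map_add]
    exact (map_add _ _ _).symm

/-- **Rational transports intertwine the fibre maps of an endomorphism over the base**: for
`g ≫ π = π` and a rational transport `T` along a path class `δ` from `s` to `t`,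
`T ∘ (g_s)^* = (g_t)^* ∘ T` on `Hᵏ(X_s(ℂ); ℚ)` (the tree's `transportFun_map_fiberHom` read through
the injective `a ↦ a ⊗ 1`). [cite: VoisinHodgeII2003, §3.1.2] -/
theorem ratTransport_pull_fiberOverEnd (π : 𝒳 ⟶ S) (k : ℕ)
    (hU : IsCohomologicallyLocallyTrivialOn π (Set.univ : Set (ComplexPoints S)))
    (g : 𝒳 ⟶ 𝒳) (hg : g ≫ π = π) {s t : (Set.univ : Set (ComplexPoints S))}
    {δ : Path.Homotopic.Quotient s t}
    {T : bettiCohomology (fiberOver π s.1) k ≃ₗ[ℚ] bettiCohomology (fiberOver π t.1) k}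
    (hT : ∀ v, ofRatClass _ k (T v) = transportFun π k hU δ (ofRatClass _ k v))
    (v : bettiCohomology (fiberOver π s.1) k) :
    T (pull (fiberOverEnd π g hg s.1) k v) = pull (fiberOverEnd π g hg t.1) k (T v) := by
  apply ofRatClass_injective k
  rw [hT, ofRatClass_pull, ofRatClass_pull,
    transportFun_map_fiberHom π k hU g hg (fun t ↦ fiberOverEnd π g hg t)
      (fun t ↦ fiberOverEnd_comp_fiberι π g hg t) δ, hT]

/-- `pull (τ ≫ τ)_t = (pull τ_t) ^ 2` for the fibre maps of an endomorphism over the base.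
[cite: HatcherAT2002, §3.1 p. 198] -/
theorem pull_fiberOverEnd_comp_self (π : 𝒳 ⟶ S) (k : ℕ) (τ : 𝒳 ⟶ 𝒳) (hτ : τ ≫ π = π)
    (hττ : (τ ≫ τ) ≫ π = π) (t : ComplexPoints S) :
    pull (fiberOverEnd π (τ ≫ τ) hττ t) k = (pull (fiberOverEnd π τ hτ t) k) ^ 2 := by
  rw [fiberOverEnd_congr π rfl hττ (by rw [Category.assoc, hτ, hτ]) t, fiberOverEnd_comp π τ τ hτ hτ t,
    pull_comp_eq_mul, pow_two]

/-- **The top Hodge piece is the last step of the Hodge filtration**: `F^k Hᵏ(X) = H^{k,0}(X)`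
(the pieces `H^{i,k−i}` with `i > k` vanish). [cite: VoisinHodgeI2002, §7.1.1 Def. 7.4] -/
theorem hodge_F_self_eq_piece_self_zero (hHD : exists_isReal_hodgeModel) {n : ℕ} {X : SchemeOver ℂ}
    (hX : IsSmoothProjective n X) (k : ℕ) :
    (hodge hHD hX k).F k = (hodge hHD hX k).piece k 0 := by
  refine le_antisymm ?_ ?_
  · rw [Motives.HodgeStructure.F_eq_iSup_piece_holds (hodge hHD hX k) k, iSup₂_le_iff]
    intro i hi
    rcases hi.lt_or_eq with hlt | heq
    · rw [hodge_piece_eq_bot_of_lt hHD hX k hlt]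
      exact bot_le
    · rw [← heq, sub_self]
  · exact Motives.HodgeStructure.piece_le_F _ _ _

/-! ### §3 Constancy of the eigen-Hodge numbers over an irreducible base -/

/-- Core of `finrank_eigenspace_pull_fiberOverEnd_inf_hodge_F_eq` for an eigenvalue which IS an
`m`-th root of unity (the flat splitting by the eigenspaces of `g_s^* ⊗ ℂ` has constant piece-wise
Hodge numbers; read back at `t` through a rational transport).
[cite: VoisinHodgeI2002, §9.3.1 Prop. 9.20 and §10.2.1 Thm. 10.3] [cite: Deligne1987, §1.11–1.13 (p. 10–11)] -/
theorem finrank_eigenspace_inf_F_eq_of_mem_nthRoots (hHD : exists_isReal_hodgeModel)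
    (π : 𝒳 ⟶ S) (n k d : ℕ) (hπ : IsSmoothProjectiveFamily π n)
    (h𝒳 : IsQuasiProjectiveOver 𝒳) (hS : IsQuasiProjectiveOver S)
    [AlgebraicGeometry.SmoothOfRelativeDimension d S.hom] [IrreducibleSpace S.left]
    (hU : IsCohomologicallyLocallyTrivialOn π (Set.univ : Set (ComplexPoints S)))
    (g : 𝒳 ⟶ 𝒳) (hg : g ≫ π = π) (m : ℕ) (hm : 0 < m)
    (hB : ∀ t : ComplexPoints S, ((pull (fiberOverEnd π g hg t) k).baseChange ℂ) ^ m = 1)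
    (p : ℤ) (s t : (Set.univ : Set (ComplexPoints S))) (μ : ↥(Polynomial.nthRootsFinset m (1 : ℂ))) :
    finrank ℂ ↥(Module.End.eigenspace ((pull (fiberOverEnd π g hg t.1) k).baseChange ℂ) (μ : ℂ) ⊓
        (hodge hHD (hπ.isSmoothProjective t.1) k).F p) =
      finrank ℂ ↥(Module.End.eigenspace ((pull (fiberOverEnd π g hg s.1) k).baseChange ℂ) (μ : ℂ) ⊓
        (hodge hHD (hπ.isSmoothProjective s.1) k).F p) := by
  classical
  haveI hfin : ∀ t : ComplexPoints S, Module.Finite ℚ (bettiCohomology (fiberOver π t) k) :=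
    fun t ↦ finite (hπ.isSmoothProjective t) k
  -- the real Hodge models of the fibres (`(Am t).hodgeStructure … k = hodge hHD … k` definitionally)
  let Am : ∀ t : ComplexPoints S, HodgeModel n (fiberOver π t) := fun t ↦
    realHodgeModel hHD (hπ.isSmoothProjective t)
  have hAm : ∀ t, (Am t).IsHodgeSymmetric := fun t ↦
    realHodgeModel_isHodgeSymmetric hHD (hπ.isSmoothProjective t)
  have hhodge : ∀ u : ComplexPoints S,
      hodge hHD (hπ.isSmoothProjective u) k = (Am u).hodgeStructure (hπ.isSmoothProjective u) (hAm u) k :=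
    fun u ↦ rfl
  -- the complexified fibrewise action on `Hᵏ(X_t(ℂ); ℂ)`: flat and type-preserving
  let τC : ∀ u : (Set.univ : Set (ComplexPoints S)),
      complexBetti (fiberOver π u.1) k →ₗ[ℂ] complexBetti (fiberOver π u.1) k := fun u ↦
    (complexBetti.map (fiberOverEnd π g hg u.1) k).hom
  have hτC : ∀ (u : (Set.univ : Set (ComplexPoints S))) (y : complexBetti (fiberOver π u.1) k),
      τC u y = complexBetti.map (fiberOverEnd π g hg u.1) k y := fun u y ↦ rfl
  have hflat : ∀ (u : (Set.univ : Set (ComplexPoints S))) (γ : Path.Homotopic.Quotient s u)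
      (x : complexBetti (fiberOver π s.1) k),
      transportFun π k hU γ (τC s x) = τC u (transportFun π k hU γ x) :=
    fun u γ x ↦ transportFun_map_fiberHom π k hU g hg (fun t ↦ fiberOverEnd π g hg t)
      (fun t ↦ fiberOverEnd_comp_fiberι π g hg t) γ x
  have htype : ∀ (u : (Set.univ : Set (ComplexPoints S))) (p q : ℕ) (x : complexBetti (fiberOver π u.1) k),
      IsOfHodgeType n (fiberOver π u.1) k p q x → IsOfHodgeType n (fiberOver π u.1) k p q (τC u x) :=
    fun u p q x hx ↦ IsOfHodgeType.map_endomorphism (hπ.isSmoothProjective u.1) (fiberOverEnd π g hg u.1) hx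
  -- the eigenspaces of `τC s` read on `ℂ ⊗_ℚ Hᵏ(X_s; ℚ)` are those of `A_s ⊗ ℂ`
  have hKcomap : ∀ ν : ℂ, (Module.End.eigenspace (τC s) ν).comap
      (ofRatClassBaseChangeEquiv (hπ.isSmoothProjective s.1) k).toLinearMap =
      Module.End.eigenspace ((pull (fiberOverEnd π g hg s.1) k).baseChange ℂ) ν := by
    intro ν
    ext x
    rw [Submodule.mem_comap, Module.End.mem_eigenspace_iff, Module.End.mem_eigenspace_iff,
      LinearEquiv.coe_coe, hτC, ofRatClassBaseChangeEquiv_apply, ← ofRatClassBaseChange_baseChange_pull_eq,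
      ← map_smul, (ofRatClassBaseChange_injective _ k).eq_iff]
  -- the flat splitting at `s` by the eigenspaces for the `m`-th roots of unity
  let K : ↥(Polynomial.nthRootsFinset m (1 : ℂ)) →
      Submodule ℂ (ℂ ⊗[ℚ] bettiCohomology (fiberOver π s.1) k) := fun ν ↦
    Module.End.eigenspace ((pull (fiberOverEnd π g hg s.1) k).baseChange ℂ) (ν : ℂ)
  have hKdef : ∀ ν, K ν = Module.End.eigenspace ((pull (fiberOverEnd π g hg s.1) k).baseChange ℂ) (ν : ℂ) :=
    fun ν ↦ rfl
  have hind : iSupIndep K := iSupIndep_eigenspace_nthRoots _ m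
  have htop : ⨆ ν, K ν = ⊤ := iSup_eigenspace_nthRoots_eq_top hm (hB s.1)
  -- additivity at every admissible state, from the sub-variation property of the eigenspaces
  have hadd : ∀ (t' : (Set.univ : Set (ComplexPoints S))) (δ : Path.Homotopic.Quotient s t')
      (T : singularCohomology ℚ ℚ (ComplexPoints (fiberOver π s.1)) k ≃ₗ[ℚ]
        singularCohomology ℚ ℚ (ComplexPoints (fiberOver π t'.1)) k),
      (∀ v, ofRatClass _ k (T v) = transportFun π k hU δ (ofRatClass _ k v)) →
      ∑ ν, finrank ℂ ↥(K ν ⊓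
          (((Am t'.1).hodgeStructure (hπ.isSmoothProjective t'.1) (hAm t'.1) k).comapEquiv T).F p) =
        finrank ℂ ↥((((Am t'.1).hodgeStructure (hπ.isSmoothProjective t'.1) (hAm t'.1) k).comapEquiv T).F p) := by
    intro t' δ T hT
    refine HodgeStructure.sum_finrank_inf_F_eq_of_splitting _ K hind htop (fun ν ↦ ?_) p
    have hsub : IsSubvariation π k hU n s (Module.End.eigenspace (τC s) (ν : ℂ)) :=
      isSubvariation_eigenspace (fun t ↦ hπ.isSmoothProjective t.1) τC hflat htype (ν : ℂ)
    have hL : IsHodgeSubspace n (fiberOver π t'.1) k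
        ((Module.End.eigenspace (τC s) (ν : ℂ)).map (transportLinear π k hU δ)) :=
      hsub t' δ
    have hbr := comap_eq_iSup_inf_piece_comapEquiv_of_isHodgeSubspace_map (s := s) (t := t') (γ := δ)
      (T := T) hT (hπ.isSmoothProjective s.1) (hπ.isSmoothProjective t'.1) (Am t'.1) (hAm t'.1) hL
    rw [hKcomap] at hbr
    rw [hKdef]
    exact hbr
  -- constancy along a path from `s` to `t`
  obtain ⟨δ, T, hT, hdim⟩ := flatSplitting_finrank_inf_F_eq_forall_of_irreducibleSpace π n k d hπ hS h𝒳
    hU Am hAm s p K hadd t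
  have key := hdim μ
  rw [hKdef] at key
  -- read the two sides: at `s` the state is the identity ...
  have hrhs : finrank ℂ ↥(Module.End.eigenspace ((pull (fiberOverEnd π g hg s.1) k).baseChange ℂ) (μ : ℂ) ⊓
      (((Am s.1).hodgeStructure (hπ.isSmoothProjective s.1) (hAm s.1) k).comapEquiv
        (LinearEquiv.refl ℚ _)).F p) =
      finrank ℂ ↥(Module.End.eigenspace ((pull (fiberOverEnd π g hg s.1) k).baseChange ℂ) (μ : ℂ) ⊓
      (hodge hHD (hπ.isSmoothProjective s.1) k).F p) := by
    rw [Motives.HodgeStructure.comapEquiv_F, LinearEquiv.refl_toLinearMap, LinearMap.baseChange_id,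
      Submodule.comap_id, hhodge]
  -- ... and at `t` the transport `T` identifies eigenspaces and filtrations
  have hEt : Module.End.eigenspace ((pull (fiberOverEnd π g hg s.1) k).baseChange ℂ) (μ : ℂ) =
      (Module.End.eigenspace ((pull (fiberOverEnd π g hg t.1) k).baseChange ℂ) (μ : ℂ)).comap
        ((T : _ →ₗ[ℚ] _).baseChange ℂ) :=
    (comap_baseChange_eigenspace_eq_of_semiconj T _ _
      (fun v ↦ ratTransport_pull_fiberOverEnd π k hU g hg (s := s) (t := t) (δ := δ) (T := T) hT v)
      (μ : ℂ)).symm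
  have hlhs : finrank ℂ ↥(Module.End.eigenspace ((pull (fiberOverEnd π g hg s.1) k).baseChange ℂ) (μ : ℂ) ⊓
      (((Am t.1).hodgeStructure (hπ.isSmoothProjective t.1) (hAm t.1) k).comapEquiv T).F p) =
      finrank ℂ ↥(Module.End.eigenspace ((pull (fiberOverEnd π g hg t.1) k).baseChange ℂ) (μ : ℂ) ⊓
      (hodge hHD (hπ.isSmoothProjective t.1) k).F p) := by
    rw [Motives.HodgeStructure.comapEquiv_F, hEt, ← Submodule.comap_inf, ← LinearEquiv.coe_baseChange,
      Submodule.comap_equiv_eq_map_symm, LinearEquiv.finrank_map_eq, hhodge]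
  rw [← hlhs, ← hrhs]
  exact key

/-- **The eigen-Hodge numbers of a fibrewise endomorphism of finite order are the same at every
member.** `π : 𝒳 → S` smooth projective of relative dimension `n`, `𝒳`, `S` quasi-projective, `S`
smooth of dimension `d` and irreducible, `Rᵏ π_* ℂ` locally trivial (`hU`), `g : 𝒳 → 𝒳` over `S` with
`(g_t^*)^m = 1` on `Hᵏ(X_t(ℂ); ℚ)` for all `t` (`m ≥ 1`). Then for every `c : ℂ`, `p : ℤ`, `s, t ∈ S(ℂ)`:
`dim_ℂ (ker(g_t^* ⊗ ℂ − c) ∩ F^p Hᵏ(X_t)) = dim_ℂ (ker(g_s^* ⊗ ℂ − c) ∩ F^p Hᵏ(X_s))`.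
Proof: the eigenspaces of `g_s^* ⊗ ℂ` (for the `m`-th roots of unity) form a flat splitting by
complex sub-variations (`isSubvariation_eigenspace`), whose piece-wise Hodge numbers are constant
along every path (`flatSplitting_finrank_inf_F_eq_forall_of_irreducibleSpace`, Voisin I Prop. 9.20
over Griffiths' holomorphy), and a rational transport identifies the pieces and the filtrations
at the two ends (`ratTransport_pull_fiberOverEnd`). For `c ^ m ≠ 1` both sides vanish.
[cite: VoisinHodgeI2002, §9.3.1 Prop. 9.20 and §10.2.1 Thm. 10.3] [cite: Deligne1987, §1.11–1.13 (p. 10–11)] -/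
theorem finrank_eigenspace_pull_fiberOverEnd_inf_hodge_F_eq (hHD : exists_isReal_hodgeModel)
    (π : 𝒳 ⟶ S) (n k d : ℕ) (hπ : IsSmoothProjectiveFamily π n)
    (h𝒳 : IsQuasiProjectiveOver 𝒳) (hS : IsQuasiProjectiveOver S)
    [AlgebraicGeometry.SmoothOfRelativeDimension d S.hom] [IrreducibleSpace S.left]
    (hU : IsCohomologicallyLocallyTrivialOn π (Set.univ : Set (ComplexPoints S)))
    (g : 𝒳 ⟶ 𝒳) (hg : g ≫ π = π) (m : ℕ) (hm : 0 < m)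
    (hgm : ∀ t : ComplexPoints S, (pull (fiberOverEnd π g hg t) k) ^ m = 1)
    (c : ℂ) (p : ℤ) (s t : ComplexPoints S) :
    finrank ℂ ↥(Module.End.eigenspace ((pull (fiberOverEnd π g hg t) k).baseChange ℂ) c ⊓
        (hodge hHD (hπ.isSmoothProjective t) k).F p) =
      finrank ℂ ↥(Module.End.eigenspace ((pull (fiberOverEnd π g hg s) k).baseChange ℂ) c ⊓
        (hodge hHD (hπ.isSmoothProjective s) k).F p) := by
  classical
  haveI hfin : ∀ t : ComplexPoints S, Module.Finite ℚ (bettiCohomology (fiberOver π t) k) :=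
    fun t ↦ finite (hπ.isSmoothProjective t) k
  -- complexified operators of finite order: eigenvalues are `m`-th roots of unity
  have hB : ∀ t : ComplexPoints S, ((pull (fiberOverEnd π g hg t) k).baseChange ℂ) ^ m = 1 :=
    fun t ↦ by rw [← LinearMap.baseChange_pow, hgm t, LinearMap.baseChange_one]
  by_cases hc : c ^ m = 1
  · exact finrank_eigenspace_inf_F_eq_of_mem_nthRoots hHD π n k d hπ h𝒳 hS hU g hg m hm hB p
      ⟨s, Set.mem_univ s⟩ ⟨t, Set.mem_univ t⟩ ⟨c, (Polynomial.mem_nthRootsFinset hm 1).2 hc⟩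
  · rw [eigenspace_eq_bot_of_pow_eq_one_of_pow_ne_one (hB t) hc,
      eigenspace_eq_bot_of_pow_eq_one_of_pow_ne_one (hB s) hc, bot_inf_eq, bot_inf_eq, finrank_bot,
      finrank_bot]

/-- **The same for the SQUARE of a fibrewise automorphism** (the route's `τ²`): with
`A_t := (τ_t)^*` and `((A_t)²)^m = 1` for all `t`,
`dim(ker(A_t² ⊗ ℂ − c) ∩ F^p Hᵏ(X_t))` is independent of `t`.
[cite: VoisinHodgeI2002, §9.3.1 Prop. 9.20 and §10.2.1 Thm. 10.3] [cite: Deligne1987, §1.11–1.13 (p. 10–11)] -/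
theorem finrank_eigenspace_pull_fiberOverEnd_sq_inf_hodge_F_eq (hHD : exists_isReal_hodgeModel)
    (π : 𝒳 ⟶ S) (n k d : ℕ) (hπ : IsSmoothProjectiveFamily π n)
    (h𝒳 : IsQuasiProjectiveOver 𝒳) (hS : IsQuasiProjectiveOver S)
    [AlgebraicGeometry.SmoothOfRelativeDimension d S.hom] [IrreducibleSpace S.left]
    (hU : IsCohomologicallyLocallyTrivialOn π (Set.univ : Set (ComplexPoints S)))
    (τ : 𝒳 ⟶ 𝒳) (hτ : τ ≫ π = π) (m : ℕ) (hm : 0 < m)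
    (hτm : ∀ t : ComplexPoints S, ((pull (fiberOverEnd π τ hτ t) k) ^ 2) ^ m = 1)
    (c : ℂ) (p : ℤ) (s t : ComplexPoints S) :
    finrank ℂ ↥(Module.End.eigenspace (((pull (fiberOverEnd π τ hτ t) k) ^ 2).baseChange ℂ) c ⊓
        (hodge hHD (hπ.isSmoothProjective t) k).F p) =
      finrank ℂ ↥(Module.End.eigenspace (((pull (fiberOverEnd π τ hτ s) k) ^ 2).baseChange ℂ) c ⊓
        (hodge hHD (hπ.isSmoothProjective s) k).F p) := by
  have hττ : (τ ≫ τ) ≫ π = π := by rw [Category.assoc, hτ, hτ]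
  have hsq : ∀ t, pull (fiberOverEnd π (τ ≫ τ) hττ t) k = (pull (fiberOverEnd π τ hτ t) k) ^ 2 :=
    fun t ↦ pull_fiberOverEnd_comp_self π k τ hτ hττ t
  have h := finrank_eigenspace_pull_fiberOverEnd_inf_hodge_F_eq hHD π n k d hπ h𝒳 hS hU (τ ≫ τ) hττ m hm
    (fun t ↦ by rw [hsq]; exact hτm t) c p s t
  rwa [hsq, hsq] at h

/-- **Top-piece form**: `dim(ker(g_t^* ⊗ ℂ − c) ∩ H^{k,0}(X_t))` is independent of `t` (the case
`p = k`, `F^k = H^{k,0}`). [cite: VoisinHodgeI2002, §9.3.1 Prop. 9.20 and §10.2.1 Thm. 10.3]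
[cite: Deligne1987, §1.11–1.13 (p. 10–11)] -/
theorem finrank_eigenspace_pull_fiberOverEnd_inf_hodge_piece_eq (hHD : exists_isReal_hodgeModel)
    (π : 𝒳 ⟶ S) (n k d : ℕ) (hπ : IsSmoothProjectiveFamily π n)
    (h𝒳 : IsQuasiProjectiveOver 𝒳) (hS : IsQuasiProjectiveOver S)
    [AlgebraicGeometry.SmoothOfRelativeDimension d S.hom] [IrreducibleSpace S.left]
    (hU : IsCohomologicallyLocallyTrivialOn π (Set.univ : Set (ComplexPoints S)))
    (g : 𝒳 ⟶ 𝒳) (hg : g ≫ π = π) (m : ℕ) (hm : 0 < m)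
    (hgm : ∀ t : ComplexPoints S, (pull (fiberOverEnd π g hg t) k) ^ m = 1)
    (c : ℂ) (s t : ComplexPoints S) :
    finrank ℂ ↥(Module.End.eigenspace ((pull (fiberOverEnd π g hg t) k).baseChange ℂ) c ⊓
        (hodge hHD (hπ.isSmoothProjective t) k).piece k 0) =
      finrank ℂ ↥(Module.End.eigenspace ((pull (fiberOverEnd π g hg s) k).baseChange ℂ) c ⊓
        (hodge hHD (hπ.isSmoothProjective s) k).piece k 0) := by
  rw [← hodge_F_self_eq_piece_self_zero hHD (hπ.isSmoothProjective t) k,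
    ← hodge_F_self_eq_piece_self_zero hHD (hπ.isSmoothProjective s) k]
  exact finrank_eigenspace_pull_fiberOverEnd_inf_hodge_F_eq hHD π n k d hπ h𝒳 hS hU g hg m hm hgm c k s t

/-- **The K1Q (o)(o′) numbers are the same at every member** — the shape of stub S4 of crux K1Q of
route `HodgeConjecture/Q8SymplecticPowers` verbatim: for a smooth projective family of SURFACES
`π : 𝒳 → S` over an irreducible smooth quasi-projective base and `τ : 𝒳 → 𝒳` over `S` with
`((τ_t^*)²)^m = 1` on `H²` (e.g. `τ⁴ = 𝟙`, `m = 2`), for every `c` (e.g. `c = ±1`) and all `s, t ∈ S(ℂ)`: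
`dim_ℂ (ker((τ_t^*)² ⊗ ℂ − c) ∩ H^{2,0}(X_t)) = dim_ℂ (ker((τ_s^*)² ⊗ ℂ − c) ∩ H^{2,0}(X_s))`.
[cite: VoisinHodgeI2002, §9.3.1 Prop. 9.20 and §10.2.1 Thm. 10.3] [cite: Deligne1987, §1.11–1.13 (p. 10–11)] -/
theorem finrank_eigenspace_sq_inf_hodge_piece_two_zero_eq (hHD : exists_isReal_hodgeModel)
    (π : 𝒳 ⟶ S) (d : ℕ) (hπ : IsSmoothProjectiveFamily π 2)
    (h𝒳 : IsQuasiProjectiveOver 𝒳) (hS : IsQuasiProjectiveOver S)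
    [AlgebraicGeometry.SmoothOfRelativeDimension d S.hom] [IrreducibleSpace S.left]
    (hU : IsCohomologicallyLocallyTrivialOn π (Set.univ : Set (ComplexPoints S)))
    (τ : 𝒳 ⟶ 𝒳) (hτ : τ ≫ π = π) (m : ℕ) (hm : 0 < m)
    (hτm : ∀ t : ComplexPoints S, ((pull (fiberOverEnd π τ hτ t) 2) ^ 2) ^ m = 1)
    (c : ℂ) (s t : ComplexPoints S) :
    finrank ℂ ↥(Module.End.eigenspace (((pull (fiberOverEnd π τ hτ t) 2) ^ 2).baseChange ℂ) c ⊓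
        (hodge hHD (hπ.isSmoothProjective t) 2).piece 2 0) =
      finrank ℂ ↥(Module.End.eigenspace (((pull (fiberOverEnd π τ hτ s) 2) ^ 2).baseChange ℂ) c ⊓
        (hodge hHD (hπ.isSmoothProjective s) 2).piece 2 0) := by
  have h := finrank_eigenspace_pull_fiberOverEnd_sq_inf_hodge_F_eq hHD π 2 2 d hπ h𝒳 hS hU τ hτ m hm hτm
    c 2 s t
  have e2 : ∀ u : ComplexPoints S, (hodge hHD (hπ.isSmoothProjective u) 2).F 2 =
      (hodge hHD (hπ.isSmoothProjective u) 2).piece 2 0 := fun u ↦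
    hodge_F_self_eq_piece_self_zero hHD (hπ.isSmoothProjective u) 2
  rw [e2, e2] at h
  exact h

/-- **The pair «(o) ∧ (o′)» at one base point gives it at every base point.** For a smooth
projective family of surfaces `π : 𝒳 → S` over an irreducible smooth quasi-projective base with a
fibrewise automorphism `τ` over `S` acting with `(τ_t^*)⁴ = 1` on `H²(X_t; ℚ)` (all `t`): if at ONE
point `s₀` the `(+1)`-eigenspace of `(τ_{s₀}^*)² ⊗ ℂ` meets `H^{2,0}(X_{s₀})` trivially («(o)») and
the `(−1)`-eigenspace meets it non-trivially («(o′)»), then the same two clauses hold at EVERY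
`s ∈ S(ℂ)` — both dimensions are constant in `s` (`finrank_eigenspace_sq_inf_hodge_piece_two_zero_eq`
with `m = 2`, `c = ±1`). Stated in the shape of the hypothesis `ho` of the summit-side packaging of
K1Q stub S4 (general Hodge-model witness `hHD`; the cell instantiates `exists_isReal_hodgeModel_holds`).
[cite: VoisinHodgeI2002, §9.3.1 Prop. 9.20 and §10.2.1 Thm. 10.3] -/
theorem eigenspace_sq_inf_piece_two_zero_clauses_forall (hHD : exists_isReal_hodgeModel)
    (π : 𝒳 ⟶ S) (d : ℕ) (hπ : IsSmoothProjectiveFamily π 2)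
    (h𝒳 : IsQuasiProjectiveOver 𝒳) (hS : IsQuasiProjectiveOver S)
    [AlgebraicGeometry.SmoothOfRelativeDimension d S.hom] [IrreducibleSpace S.left]
    (hU : IsCohomologicallyLocallyTrivialOn π (Set.univ : Set (ComplexPoints S)))
    (τ : 𝒳 ⟶ 𝒳) (hτ : τ ≫ π = π)
    (hτ4 : ∀ t : ComplexPoints S, (pull (fiberOverEnd π τ hτ t) 2) ^ 4 = 1)
    (s₀ : ComplexPoints S)
    (ho₀ : finrank ℂ ↥(Module.End.eigenspace (((pull (fiberOverEnd π τ hτ s₀) 2) ^ 2).baseChange ℂ) 1 ⊓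
          (hodge hHD (hπ.isSmoothProjective s₀) 2).piece 2 0) = 0 ∧
      0 < finrank ℂ ↥(Module.End.eigenspace (((pull (fiberOverEnd π τ hτ s₀) 2) ^ 2).baseChange ℂ) (-1) ⊓
          (hodge hHD (hπ.isSmoothProjective s₀) 2).piece 2 0))
    (s : ComplexPoints S) :
    finrank ℂ ↥(Module.End.eigenspace (((pull (fiberOverEnd π τ hτ s) 2) ^ 2).baseChange ℂ) 1 ⊓
          (hodge hHD (hπ.isSmoothProjective s) 2).piece 2 0) = 0 ∧
      0 < finrank ℂ ↥(Module.End.eigenspace (((pull (fiberOverEnd π τ hτ s) 2) ^ 2).baseChange ℂ) (-1) ⊓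
          (hodge hHD (hπ.isSmoothProjective s) 2).piece 2 0) := by
  have hτm : ∀ t : ComplexPoints S, ((pull (fiberOverEnd π τ hτ t) 2) ^ 2) ^ 2 = 1 := fun t ↦ by
    rw [← pow_mul]; exact hτ4 t
  have h1 := finrank_eigenspace_sq_inf_hodge_piece_two_zero_eq hHD π d hπ h𝒳 hS hU τ hτ 2 two_pos hτm
    1 s₀ s
  have h2 := finrank_eigenspace_sq_inf_hodge_piece_two_zero_eq hHD π d hπ h𝒳 hS hU τ hτ 2 two_pos hτm
    (-1) s₀ s
  exact ⟨h1.trans ho₀.1, by rw [h2]; exact ho₀.2⟩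

end Family

end HodgeTheory

end Literature.AlgebraicGeometry.HodgeTheory

end
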